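import Summits.BirchSwinnertonDyer.Rank1Residual.X11b.BDPRouteSelmerCardBoundTorsion
import Summits.BirchSwinnertonDyer.Rank1Residual.X11b.LocalPrimaryCohomologyEP
import Summits.BirchSwinnertonDyer.Rank1Residual.Additive.LocalLogImageRat
import Literature.NumberTheory.GaloisCohomology.PoitouTateNumberField
import HarnessLib

/-!
# Route `BiquadraticEisensteinDescent`, crux C′ `ControlCMInertBadAdmOther` (stmt-BirchSwinnertonDyer-20454):
# the UPPER half of anticyclotomic control at an ADDITIVE prime `p` split in `K` — file 1 (kernel)

Seat `bsd-wall-bed-p3` (prover, cell `bsd-wall`, rung W-ALL row CornerF / K12i). Theorems only; no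
definition, no named fact, no `sorry`. Stated for an arbitrary globally minimal `E/ℚ` with ADDITIVE
reduction at `p` and `E(K)[p] = 0` over an imaginary quadratic `K` in which `p` splits; the CM-inert-bad
specialisation and the crux-shaped statement are in the sequel `…ControlCMInertBadAdmOther.lean`.

The crux asks `∃ n, ord_p f_ac(0) = n ∧ n ≤ ord_p #Ш(E/K)[p^∞] + 2·(ord_p log_ω P − ord_p[E(K):ℤP]) +
ord_p ∏_{w∣N⁺} c_w(E/K)` — the control INEQUALITY in the additive normalisation (no Euler factor, no
"`− 1`": `[E(ℚ_p) : E₁(ℚ_p)] = c_p · #Ẽ_ns(𝔽_p) = c_p · p`). Sub-cell multr1-p2 (b2b) proved this at a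
MULTIPLICATIVE `p` (`X11b.p2SelmerCardBoundTorsion_of_facts`, `X11b.controlUpperOnTreeAt_of_selmerCardBound_torsion`)
from Poitou–Tate (sum of local pairings) and Tate's local Euler characteristic — both now TREE THEOREMS
(`poitouTate_sum_localTatePairing_eq_zero_holds`, `localEulerPoincareCharacteristic_adicCompletionEP`). The
reduction type enters only through `v(Ψ P_ι) = ord_p log_ω P + ord_p c_p + ord_p #Ẽ_ns(𝔽_p) − 1`
(`LocalIndex.exists_addEquiv_valuation_psi_padicPointOf`); additive ⇒ `#Ẽ_ns(𝔽_p) = p`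
(`Additive.LocalLog.reductionPointCount_of_addv`).

* §1 `additiveSelmerCardBoundTorsion_of_rankOne` — `#Sel_𝔭(K, E[p^∞]) · #E(ℚ_p)[p^∞] ≤ p^a`,
  `a ≤ ord_p #Ш + 2·(ord_p log_{ω,𝔭} P − ord_p[E(K):ℤP]) + ord_p ∏_{w∣p} c_w`, given rank one, `Ш` finite.
* §2 `exists_hasCharValuationAt_le_of_natCard_invariants_le` (Greenberg's criterion, counting form) and
  `exists_hasCharValuationAt_le_of_selmerCardBound_torsion` (counting snake lemma with the strict place
  counted, Lemma 3.3 at `Σ(N⁺)` and above `p`, away descent): `n + ord_p ∏_{w∣p} c_w ≤ a + ord_p ∏_{w∣N⁺} c_w`.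
(The two are composed at a frame, and specialised to the CM-inert-bad crux, in the sequel.)

Credits: b2b-bsdres multr1-p1/p2 (every kernel lemma), bsd-schneider door (the additive exponent).
References: [JetchevSkinnerWan2017] Prop. 3.2.1, Thm. 3.3.1, §3.3, (7.1.5), §7.4.1 (arXiv:1512.06894);
[GreenbergLNM1716] §3 Lemma 3.3, p. 90, §4 Lemma 4.2; [Castella2018] Thm. 2.3, (3.2.1), (calcul)
(arXiv:1704.06608 pp. 5–6); [MilneADT2006] I Thm. 2.8, Thm. 4.10(b); [SilvermanAEC2009] VII.2.1, VII.6.1.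
-/

noncomputable section

open scoped Classical

open WeierstrassCurve NumberField IsDedekindDomain Field
open Literature.NumberTheory.EllipticCurves Literature.NumberTheory.EllipticCurves.GreenbergSelmer
  Literature.NumberTheory.EllipticCurves.ModularForms
  Literature.NumberTheory.EllipticCurves.Rank1Residual
  Literature.NumberTheory.EllipticCurves.Rank1Residual.Typed
  Literature.NumberTheory.QuadraticFields.Quadratic
  Literature.NumberTheory.GaloisRepresentations Literature.NumberTheory.GaloisCohomology
  Summit.BirchSwinnertonDyer.Rank1Residual
  Summit.BirchSwinnertonDyer.Rank1Residual.X11b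
  Summit.BirchSwinnertonDyer.Rank1Residual.X11b.AcSelmer
  Summit.BirchSwinnertonDyer.Rank1Residual.X11b.LocBridge

set_option linter.dupNamespace false

namespace Summit.BirchSwinnertonDyer.BirchSwinnertonDyer.Theorems.BiquadraticEisensteinDescentControlCMInertBadAdmOtherAdditiveCount

/-! ## §1. The torsion-weighted base Selmer count at an ADDITIVE prime -/

section Count

/-- **The torsion-weighted Selmer bound at an ADDITIVE prime split in `K`.** For a globally minimal
elliptic `W/ℚ` with additive reduction at `p`, an imaginary quadratic `K` with `p = 𝔭𝔭̄` split,
`E(K)[p] = 0`, `rank_ℤ E(K) = 1`, `Ш(E/K)` finite, a non-torsion `P ∈ E(K)` and a degree-one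
`𝔭 ∋ p`: Castella's `Sel_𝔭(K, E[p^∞])` (strict at `𝔭` and at every `w ∤ p`, relaxed at `𝔭̄`) is finite
with `#Sel_𝔭(K, E[p^∞]) · #E(ℚ_p)[p^∞] ≤ p^a`,
`a ≤ ord_p #Ш(E/K)[p^∞] + 2·(ord_p log_{ω,𝔭} P − ord_p[E(K):ℤP]) + ord_p ∏_{w∣p} c_w(E/K)` (the log
along `embAt K p 𝔭`). X11b's `p2SelmerCardBoundTorsion_of_facts` VERBATIM (Poitou–Tate sum of local
pairings and Tate's local Euler characteristic — both tree theorems —, level structures, the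
`ℤ_p`-coordinate `Ψ` on `E(ℚ_p)` with `Ψ(E(ℚ_p)) = p^m ℤ_p`, `p^m = #E(ℚ_p)[p^∞]`, passage to the
limit), except for the local exponent: `v(Ψ P_ι) = ord_p log_ω P + ord_p c_p + ord_p #Ẽ_ns(𝔽_p) − 1`
with `#Ẽ_ns(𝔽_p) = p` at an additive prime, so NO "`− 1`".
[cite: JetchevSkinnerWan2017, Prop. 3.2.1 and (7.1.5) (arXiv:1512.06894 pp. 10–11, 16)]
[cite: Castella2018, proof of Thm. 2.3, (3.2.1) and (calcul) (arXiv:1704.06608 pp. 5–6)]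
[cite: MilneADT2006, Ch. I, Thm. 4.10(b) and Thm. 2.8] [cite: SilvermanAEC2009, VII.2.1 and VII.6.1] -/
theorem additiveSelmerCardBoundTorsion_of_rankOne (W : WeierstrassCurve ℚ) [W.IsElliptic]
    [W.IsGloballyMinimal] (p : ℕ) [Fact p.Prime] (K : Type) [Field K] [NumberField K]
    (hadd : Addv W p) (hK : IsImaginaryQuadratic K) (hsplit : SplitsIn K p)
    (hivK : ∀ x : (W.baseChange K).toAffine.Point, p • x = 0 → x = 0)
    (hrank : (W.baseChange K).mordellWeilRank = 1) (hSha : (W.baseChange K).ShaFinite)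
    (P : (W.baseChange K).toAffine.Point) (hPinf : ¬ IsOfFinAddOrder P)
    (𝔭 : HeightOneSpectrum (𝓞 K)) (h𝔭 : ((p : ℕ) : 𝓞 K) ∈ 𝔭.asIdeal)
    (he : 𝔭.asIdeal.ramificationIdx (𝓞 ℚ) = 1) (hf : 𝔭.asIdeal.inertiaDeg (𝓞 ℚ) = 1) :
    ∃ (_ : Finite (selmerAcBase (W.baseChange K) p 𝔭 ∅)) (a : ℕ),
      Nat.card (selmerAcBase (W.baseChange K) p 𝔭 ∅) *
          Nat.card (AddCommGroup.primaryComponent (W.baseChange ℚ_[p]).toAffine.Point p) ≤ p ^ a ∧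
      (a : ℤ) ≤
        (padicValNat p (Nat.card (AddCommGroup.primaryComponent (W.baseChange K).sha p)) : ℤ) +
        2 * (padicLogOrd W p (embAt K p 𝔭 h𝔭 he hf) P -
          (padicValNat p (AddSubgroup.zmultiples P).index : ℤ)) +
          padicValNat p (tamagawaProductAbove W K p) := by
  haveI hEK : (W.baseChange K).IsElliptic := by rw [baseChange]; infer_instance
  have h2 : Module.finrank ℚ K = 2 := hK.1
  have hp : p.Prime := Fact.out
  have hPT : poitouTate_sum_localTatePairing_eq_zero K := poitouTate_sum_localTatePairing_eq_zero_holds K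
  have hEP : ∀ v : HeightOneSpectrum (𝓞 K), localEulerPoincareCharacteristic (v.adicCompletion K) :=
    fun v ↦ localEulerPoincareCharacteristic_adicCompletionEP K v
  haveI hShaFin : Finite (W.baseChange K).sha := hSha
  set ιp := embAt K p 𝔭 h𝔭 he hf with hιp
  set f : (W.baseChange K).toAffine.Point →+ (W.baseChange ℚ_[p]).toAffine.Point :=
    Affine.Point.map (W' := W) ιp.toRatAlgHom with hfdef
  have hfinj : Function.Injective f := Affine.Point.map_injective (W' := W) ιp.toRatAlgHom
  -- a coordinate `c : (W.baseChange K)(K) → ℤ` and a generator `Q`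
  obtain ⟨c, Q, hcQ, hcker⟩ := RankOne.exists_coord_of_mordellWeilRank_eq_one (W.baseChange K) hrank
  have hA : ∀ a : (W.baseChange K).toAffine.Point, IsOfFinAddOrder (a - c a • Q) :=
    RankOne.isOfFinAddOrder_sub_coord_zsmul c Q hcQ hcker
  have hQinf : ¬ IsOfFinAddOrder Q := fun hQ => by
    have h := RankOne.coord_eq_zero_of_isOfFinAddOrder c hQ
    rw [hcQ] at h
    exact one_ne_zero h
  have hxinf : ¬ IsOfFinAddOrder (f Q) := fun hx => hQinf ((hfinj.isOfFinAddOrder_iff).mp hx)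
  have hyinf : ¬ IsOfFinAddOrder (f P) := fun hy => hPinf ((hfinj.isOfFinAddOrder_iff).mp hy)
  have hcP : c P ≠ 0 := fun h0 => hPinf (hcker P h0)
  -- the `ℤ_p`-coordinate `Ψ` on `(W.baseChange K)(ℚ_p)`: `Ψ((W.baseChange K)(ℚ_p)) = p^m ℤ_p`, `p^m = #(W.baseChange K)(ℚ_p)[p^∞]`
  haveI hfi2 : ((W.baseChange ℚ_[p]).formalFiltration 2).FiniteIndex := (W.baseChange ℚ_[p]).finiteIndex_formalFiltration 2
  set cp := padicValNat p ((W.baseChange ℚ_[p]).localTamagawaNumber ℤ_[p]) with hcpdef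
  obtain ⟨φ, hφ⟩ := LocalIndex.exists_addEquiv_valuation_psi_padicPointOf W p (K := K)
  obtain ⟨m, hmrange, hmcard, hmle⟩ :=
    LocalIndex.exists_pow_eq_card_and_le_valuation_psi ((W.baseChange ℚ_[p]).formalFiltration 2) φ
  set Ψ := LocalIndex.psi ((W.baseChange ℚ_[p]).formalFiltration 2) φ with hΨ
  set eQ := (Ψ (f Q)).valuation with heQdef
  set eP := (Ψ (f P)).valuation with hePdef
  have hΨQ : Ψ (f Q) ≠ 0 := fun h0 => hxinf ((LocalIndex.psi_eq_zero_iff _ φ _).mp h0)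
  have hmeQ : m ≤ eQ := hmle (f Q) hΨQ
  -- the ADDITIVE exponent: `e(P) = padicLogOrd P + ord_p c_p` (`#Ẽ_ns(𝔽_p) = p`)
  have hns : padicValNat p (reductionPointCount W p) = 1 := by
    rw [Additive.LocalLog.reductionPointCount_of_addv W p hadd, padicValNat_self]
  have heP : (eP : ℤ) = padicLogOrd W p ιp P + cp := by
    have h : ((Ψ (f P)).valuation : ℤ) = padicLogOrd W p ιp P +
        padicValNat p ((W.baseChange ℚ_[p]).localTamagawaNumber ℤ_[p]) +
          padicValNat p (reductionPointCount W p) - 1 := hφ ιp P hyinf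
    rw [hns] at h
    rw [hePdef, hcpdef, h]
    push_cast
    ring
  have hyx : f P = c P • f Q + f (P - c P • Q) := by rw [map_sub, map_zsmul]; abel
  have hePQ : eP = padicValNat p (c P).natAbs + eQ := by
    rw [hePdef, hyx]
    exact LocalIndex.valuation_psi_zsmul_add ((W.baseChange ℚ_[p]).formalFiltration 2) φ hxinf
      (f.isOfFinAddOrder (hA P)) hcP
  -- `ord_p [(W.baseChange K)(K) : ℤP] = ord_p |c(P)|`
  haveI : Finite (AddCommGroup.torsion (W.baseChange K).toAffine.Point) := (W.baseChange K).finite_torsion_point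
  have hI : padicValNat p (AddSubgroup.zmultiples P).index = padicValNat p (c P).natAbs :=
    RankOne.padicValNat_index_zmultiples_eq c Q hcQ hcker hivK P hcP
  -- `ord_p ∏_{w∣p} c_w = 2 ord_p c_p`
  have htam : padicValNat p (tamagawaProductAbove W K p) = 2 * cp :=
    LocalIndexTransport.padicValNat_tamagawaProductAbove_eq_two_mul W K p h2 hsplit
  -- the two primes above `p`
  obtain ⟨σ, 𝔮, hσ, -, -, hall⟩ := LocalIndexTransport.exists_conj_prime_of_splitsIn K p h2 hsplit h𝔭
  have h𝔮 : ∀ v : HeightOneSpectrum (𝓞 K), v ≠ 𝔭 → ((p : ℕ) : 𝓞 K) ∈ v.asIdeal → v = 𝔮 :=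
    fun v hv hpv => (hall v hpv).resolve_left hv
  -- `#Ш[p^∞] = p^v`
  set S := Nat.card (AddCommGroup.primaryComponent (W.baseChange K).sha p) with hSdef
  obtain ⟨v, hv⟩ : ∃ v : ℕ, S = p ^ v := X11b.exists_natCard_primaryComponent_eq_pow p
  -- THE LEVEL BOUNDS
  set B : ℕ := (p ^ (eQ - m) * p ^ m) * (S * p ^ (eQ - m)) with hBdef
  have hlevel : ∀ k, Finite (acLevelStructure (W.baseChange K) p k 𝔭 ∅).selmerGroup ∧
      Nat.card (acLevelStructure (W.baseChange K) p k 𝔭 ∅).selmerGroup ≤ B := by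
    intro k
    rcases Nat.eq_zero_or_pos k with rfl | hk
    · obtain ⟨hfin, hle⟩ := finite_and_natCard_selmerGroup_acLevelStructure_zero (W.baseChange K) p 𝔭 ∅
      refine ⟨hfin, hle.trans ?_⟩
      have hS1 : 1 ≤ S := by rw [hv]; exact Nat.one_le_pow _ _ hp.pos
      calc 1 ≤ S := hS1
        _ ≤ S * p ^ (eQ - m) := Nat.le_mul_of_pos_right _ (pow_pos hp.pos _)
        _ ≤ (p ^ (eQ - m) * p ^ m) * (S * p ^ (eQ - m)) :=
            Nat.le_mul_of_pos_left _ (Nat.mul_pos (pow_pos hp.pos _) (pow_pos hp.pos _))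
    · -- the indices at level `k`, read in `(W.baseChange K)(ℚ_p)` through `Ψ`
      have hL₁ : ((Affine.Point.baseChange (W' := W.baseChange K) K (𝔭.adicCompletion K)).range ⊔
          (zsmulAddGroupHom ((p ^ k : ℕ) : ℤ) :
            ((W.baseChange K).baseChange (𝔭.adicCompletion K)).toAffine.Point →+ _).range).index ≤
          p ^ min k (eQ - m) * p ^ m := by
        rw [LocalIndexTransport.index_range_baseChange_sup_eq_padic K p 𝔭 h𝔭 he hf W,
          RankOne.range_zsmulAddGroupHom_natCast, sup_comm]
        change ((nsmulAddMonoidHom (p ^ k) : (W.baseChange ℚ_[p]).toAffine.Point →+ _).range ⊔ f.range).index ≤ _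
        rw [LocalIndex.range_nsmul_sup_range_eq_of_source f c Q hA k hivK, hmcard]
        exact LocalIndex.index_range_nsmul_sup_zmultiples_le ((W.baseChange ℚ_[p]).formalFiltration 2) φ hmrange
          (f Q) hxinf k
      have hM : (AddCommGroup.torsion ((W.baseChange K).baseChange (𝔭.adicCompletion K)).toAffine.Point ⊔
          (zsmulAddGroupHom ((p ^ k : ℕ) : ℤ) :
            ((W.baseChange K).baseChange (𝔭.adicCompletion K)).toAffine.Point →+ _).range).index =
          p ^ k := by
        rw [index_torsion_sup_range_zsmul_eq_padic K p 𝔭 h𝔭 he hf W,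
          RankOne.range_zsmulAddGroupHom_natCast]
        exact LocalIndex.index_torsion_sup_range_nsmul ((W.baseChange ℚ_[p]).formalFiltration 2) φ k
      have hN : ((zsmulAddGroupHom ((p ^ k : ℕ) : ℤ) : (W.baseChange K).toAffine.Point →+ _).range).index =
          p ^ k := RankOne.index_range_zsmul_pow_eq c Q hcQ hcker hivK k
      have hL₂ : ((Affine.Point.baseChange (W' := W.baseChange K) K (𝔭.adicCompletion K)).range ⊔
          (AddCommGroup.torsion ((W.baseChange K).baseChange (𝔭.adicCompletion K)).toAffine.Point ⊔
            (zsmulAddGroupHom ((p ^ k : ℕ) : ℤ) :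
              ((W.baseChange K).baseChange (𝔭.adicCompletion K)).toAffine.Point →+ _).range)).index =
          p ^ min k (eQ - m) := by
        rw [index_range_baseChange_sup_torsion_sup_eq_padic K p 𝔭 h𝔭 he hf W,
          RankOne.range_zsmulAddGroupHom_natCast]
        change (f.range ⊔ (AddCommGroup.torsion (W.baseChange ℚ_[p]).toAffine.Point ⊔
          (nsmulAddMonoidHom (p ^ k) : (W.baseChange ℚ_[p]).toAffine.Point →+ _).range)).index = _
        have hrw : f.range ⊔ (AddCommGroup.torsion (W.baseChange ℚ_[p]).toAffine.Point ⊔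
            (nsmulAddMonoidHom (p ^ k) : (W.baseChange ℚ_[p]).toAffine.Point →+ _).range) =
            AddCommGroup.torsion (W.baseChange ℚ_[p]).toAffine.Point ⊔
              ((nsmulAddMonoidHom (p ^ k) : (W.baseChange ℚ_[p]).toAffine.Point →+ _).range ⊔
                AddSubgroup.zmultiples (f Q)) := by
          rw [← LocalIndex.range_nsmul_sup_range_eq_of_source f c Q hA k hivK]
          ac_rfl
        rw [hrw]
        exact LocalIndex.index_torsion_sup_range_nsmul_sup_zmultiples ((W.baseChange ℚ_[p]).formalFiltration 2) φ
          hmrange (f Q) hxinf k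
      obtain ⟨hfin, hle⟩ := SelmerLevelBound.natCard_level_le_of_indices_torsion W K p k 𝔭 𝔮 hk
        σ hσ h𝔮 hPT (hEP 𝔮) rfl hM (pow_ne_zero _ hp.ne_zero) hN hL₂
        (natCard_sha_inf_torsionBy_le (W.baseChange K) p k)
      refine ⟨hfin, hle.trans ?_⟩
      have hmin : p ^ min k (eQ - m) ≤ p ^ (eQ - m) := Nat.pow_le_pow_right hp.pos (min_le_right _ _)
      exact Nat.mul_le_mul (hL₁.trans (Nat.mul_le_mul_right _ hmin))
        (Nat.mul_le_mul_left _ hmin)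
  -- pass to the limit
  obtain ⟨hfinSel, hcard⟩ := LevelKummer.exists_finite_selmerAcBase_natCard_le (W.baseChange K) p 𝔭 ∅
    (W.baseChange K).zsmul_geomPoints_surjective_holds B (fun k => (hlevel k).1) (fun k => (hlevel k).2)
  refine ⟨hfinSel, v + 2 * eQ, ?_, ?_⟩
  · rw [← hmcard]
    calc Nat.card (selmerAcBase (W.baseChange K) p 𝔭 ∅) * p ^ m ≤ B * p ^ m := Nat.mul_le_mul_right _ hcard
      _ = p ^ (v + 2 * eQ) := by
          rw [hBdef, hv, ← pow_add, ← pow_add, ← pow_add, ← pow_add]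
          congr 1
          omega
  · have hvS : padicValNat p S = v := by rw [hv, padicValNat.prime_pow]
    rw [hvS, hI, htam]
    have hePQZ : (eP : ℤ) = (padicValNat p (c P).natAbs : ℤ) + (eQ : ℤ) := by exact_mod_cast hePQ
    have hcast : (((v + 2 * eQ : ℕ) : ℤ)) = (v : ℤ) + 2 * (eQ : ℤ) := by push_cast; ring
    have hcast2 : (((2 * cp : ℕ) : ℤ)) = 2 * (cp : ℤ) := by push_cast; ring
    rw [hcast, hcast2]
    linarith [hePQZ, heP]

end Count

/-! ## §2. The control count: `∃ n, ord_p f_ac(0) = n ∧ n + ord_p ∏_{w∣p} c_w ≤ a + ord_p ∏_{w∣N⁺} c_w` -/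

section Control

variable {W : WeierstrassCurve ℚ} [W.IsElliptic] [W.IsGloballyMinimal] {K : Type} [Field K]
  [NumberField K] {p : ℕ} [Fact p.Prime] {κ : ZpExtension K p} {𝔭 : HeightOneSpectrum (𝓞 K)}
  {γ : Field.absoluteGaloisGroup K} [Fact (κ.IsTopGenerator γ)]

omit [W.IsGloballyMinimal] in
/-- **Greenberg's criterion, counting form.** If `Sel_𝔭(K_∞, E[p^∞])^γ` is finite of order `≤ p^m`,
then `X_ac = X_𝔭(E_K[p^∞])` is `Λ`-torsion with a generator `f` of its characteristic ideal,
`f(0) ≠ 0`, and `ord_p f(0) = n ≤ m` (`#Sel^γ = p^n · #Sel_γ ≥ p^n`, Lemma 4.2; `#Sel_γ ≥ 1` since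
`Sel_γ` is a quotient of a non-empty group, and finite once `Sel^γ` is: if its `Nat.card` were `0`
then `#Sel^γ = 0`). X11b's `controlUpperOnTreeAt_of_natCard_invariants_le` with the right-hand side
left abstract. [cite: GreenbergLNM1716, §4 Lemma 4.2 (p. 102)] -/
theorem exists_hasCharValuationAt_le_of_natCard_invariants_le
    (hfin : Finite (IwasawaDual.endInvariants (conjSelmerAc (W.baseChange K) p κ 𝔭 ∅ γ - 1)))
    {m : ℕ}
    (hle : Nat.card (IwasawaDual.endInvariants (conjSelmerAc (W.baseChange K) p κ 𝔭 ∅ γ - 1)) ≤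
      p ^ m) :
    ∃ n : ℕ, XAc.HasCharValuationAt (W.baseChange K) p κ 𝔭 ∅ γ n ∧ n ≤ m := by
  have hp : p.Prime := Fact.out
  obtain ⟨n, hn⟩ := exists_hasCharValuationAt_of_finite_invariants p κ 𝔭 γ hfin (W := W)
  refine ⟨n, hn, ?_⟩
  haveI := module_finite_XAc_baseChange p κ 𝔭 γ (W := W)
  obtain ⟨hfin', hcard⟩ := (XAc.hasCharValuationAt_iff_card _ p κ 𝔭 ∅ γ n).mp hn
  have hcoinv : 1 ≤ Nat.card (IwasawaDual.EndCoinvariants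
      (conjSelmerAc (W.baseChange K) p κ 𝔭 ∅ γ - 1)) := by
    rcases Nat.eq_zero_or_pos (Nat.card (IwasawaDual.EndCoinvariants
      (conjSelmerAc (W.baseChange K) p κ 𝔭 ∅ γ - 1))) with h0 | h0
    · exfalso
      rw [h0, mul_zero] at hcard
      haveI := hfin
      exact (Nat.card_pos (α := IwasawaDual.endInvariants
        (conjSelmerAc (W.baseChange K) p κ 𝔭 ∅ γ - 1))).ne' hcard
    · exact h0
  have hpow : p ^ n ≤ p ^ m := by
    calc p ^ n = p ^ n * 1 := (mul_one _).symm
      _ ≤ p ^ n * Nat.card (IwasawaDual.EndCoinvariants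
          (conjSelmerAc (W.baseChange K) p κ 𝔭 ∅ γ - 1)) := Nat.mul_le_mul_left _ hcoinv
      _ = Nat.card (IwasawaDual.endInvariants (conjSelmerAc (W.baseChange K) p κ 𝔭 ∅ γ - 1)) :=
          hcard.symm
      _ ≤ p ^ m := hle
  exact (Nat.pow_le_pow_iff_right hp.one_lt).mp hpow

/-- **The control count at a datum from ONE torsion-weighted base Selmer bound.** For `E/ℚ` over a
quadratic totally complex `K`, an anticyclotomic `κ` with generator `γ`, a degree-one `𝔭 ∣ p`, `p ∣ N_E`
split in `K`: if `Sel_𝔭(K, E[p^∞])` is finite with `#Sel_𝔭(K, E[p^∞]) · #E(ℚ_p)[p^∞] ≤ p^a`, then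
`X_𝔭(E_K[p^∞])` is torsion with `ord_p f_ac(0) = n` and
`n + ord_p ∏_{w∣p} c_w(E/K) ≤ a + ord_p ∏_{w∣N⁺} c_w(E/K)`. X11b's
`controlUpperOnTreeAt_of_selmerCardBound_torsion` with the right-hand side left abstract: the
counting snake lemma with the strict place COUNTED (`natCard_endInvariants_le_pow_of_localKer_strict`),
Greenberg's Lemma 3.3 at the split bad places `Σ(N⁺)` (`#ker r_v ≤ c_v^{(p)}`) and above `p`
(`#ker r_𝔭 ≤ #E(ℚ_p)[p^∞]`), away descent outside `Σ(N⁺) ∪ {𝔭}`, and the bookkeeping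
`ord_p ∏_{w∣N⁺} c_w = ord_p ∏_{w∣p} c_w + Σ_{Σ(N⁺)} ord_p c_v`. NO hypothesis on the reduction type
at `p` and none on `E(ℚ_p)[p]`. [cite: GreenbergLNM1716, §3 Lemma 3.3 (p. 87), p. 90]
[cite: JetchevSkinnerWan2017, §3.3 (proof of Thm. 3.3.1) (arXiv:1512.06894 pp. 11–14)]
[cite: Castella2018, Thm. 2.3 and its proof (arXiv:1704.06608 pp. 5–6)] -/
theorem exists_hasCharValuationAt_le_of_selmerCardBound_torsion [IsTotallyComplex K]
    (hK : Module.finrank ℚ K = 2) (hκ : κ.IsAnticyclotomic)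
    (h𝔭 : ((p : ℕ) : 𝓞 K) ∈ 𝔭.asIdeal) (he : 𝔭.asIdeal.ramificationIdx (𝓞 ℚ) = 1)
    (hf : 𝔭.asIdeal.inertiaDeg (𝓞 ℚ) = 1)
    (hsplit : SplitsIn K p) (hpN : p ∣ W.conductorNorm ℤ)
    [Finite (selmerAcBase (W.baseChange K) p 𝔭 ∅)]
    {a : ℕ} (ha : Nat.card (selmerAcBase (W.baseChange K) p 𝔭 ∅) *
      Nat.card (AddCommGroup.primaryComponent (W.baseChange ℚ_[p]).toAffine.Point p) ≤ p ^ a) :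
    ∃ n : ℕ, XAc.HasCharValuationAt (W.baseChange K) p κ 𝔭 ∅ γ n ∧
      n + padicValNat p (tamagawaProductAbove W K p) ≤ a + padicValNat p (tamagawaProductSplit W K) := by
  haveI hEK : (W.baseChange K).IsElliptic := by rw [baseChange]; infer_instance
  have hp : p.Prime := Fact.out
  -- `#E(ℚ_p)[p^∞] = p^m`, `#Sel ≤ p^(a - m)`, `m ≤ a`
  obtain ⟨m, hmcard⟩ := exists_natCard_primaryComponent_padic_eq_pow W p
  have hSelpos : 0 < Nat.card (selmerAcBase (W.baseChange K) p 𝔭 ∅) := Nat.card_pos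
  have hma : m ≤ a := by
    have h1 : p ^ m ≤ p ^ a := by
      calc p ^ m = 1 * p ^ m := (one_mul _).symm
        _ ≤ Nat.card (selmerAcBase (W.baseChange K) p 𝔭 ∅) * p ^ m :=
            Nat.mul_le_mul_right _ hSelpos
        _ ≤ p ^ a := by rw [← hmcard]; exact ha
    exact (Nat.pow_le_pow_iff_right hp.one_lt).mp h1
  have ha' : Nat.card (selmerAcBase (W.baseChange K) p 𝔭 ∅) ≤ p ^ (a - m) := by
    have h1 : Nat.card (selmerAcBase (W.baseChange K) p 𝔭 ∅) * p ^ m ≤ p ^ (a - m) * p ^ m := by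
      rw [← pow_add, Nat.sub_add_cancel hma, ← hmcard]; exact ha
    exact Nat.le_of_mul_le_mul_right h1 (pow_pos hp.pos m)
  -- the finite set `T = Σ(N⁺) ∪ {𝔭}`
  have hSp : ∀ v ∈ (nPlusPlaces_finite (W := W) (K := K) (p := p) hK).toFinset,
      ((p : ℕ) : 𝓞 K) ∉ v.asIdeal := fun v hv ↦
    (((nPlusPlaces_finite (W := W) (K := K) (p := p) hK).mem_toFinset).mp hv).1
  have h𝔭S : 𝔭 ∉ (nPlusPlaces_finite (W := W) (K := K) (p := p) hK).toFinset := fun h ↦ hSp 𝔭 h h𝔭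
  -- the kernel bounds: `b 𝔭 = m`, `b v = ord_p c_v` on `Σ(N⁺)`
  let b : HeightOneSpectrum (𝓞 K) → ℕ := fun v ↦
    if v = 𝔭 then m else
      padicValNat p (((W.baseChange K).baseChange (v.adicCompletion K)).localTamagawaNumber
        (v.adicCompletionIntegers K))
  have hb𝔭 : b 𝔭 = m := if_pos rfl
  have hbS : ∀ v ∈ (nPlusPlaces_finite (W := W) (K := K) (p := p) hK).toFinset,
      b v = padicValNat p (((W.baseChange K).baseChange
        (v.adicCompletion K)).localTamagawaNumber (v.adicCompletionIntegers K)) := fun v hv ↦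
    if_neg (ne_of_mem_of_not_mem hv h𝔭S)
  have hsum : a - m + ∑ v ∈ insert 𝔭 (nPlusPlaces_finite (W := W) (K := K) (p := p) hK).toFinset, b v =
      a + ∑ v ∈ (nPlusPlaces_finite (W := W) (K := K) (p := p) hK).toFinset,
        padicValNat p (((W.baseChange K).baseChange (v.adicCompletion K)).localTamagawaNumber
          (v.adicCompletionIntegers K)) := by
    rw [Finset.sum_insert h𝔭S, hb𝔭, Finset.sum_congr rfl hbS, ← add_assoc, Nat.sub_add_cancel hma]
  obtain ⟨hfin𝔭, hle𝔭⟩ := natCard_localKer_le_natCard_primaryComponent_padic W p κ 𝔭 h𝔭 he hf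
  obtain ⟨hfinγ, hle⟩ := natCard_endInvariants_le_pow_of_localKer_strict
    (W := W.baseChange K) (S := (∅ : Set (HeightOneSpectrum (𝓞 K))))
    (Fact.out : κ.IsTopGenerator γ)
    (insert 𝔭 (nPlusPlaces_finite (W := W) (K := K) (p := p) hK).toFinset)
    (Finset.mem_insert_self 𝔭 _)
    (fun v hv hv𝔭 ↦ hSp v ((Finset.mem_insert.mp hv).resolve_left hv𝔭))
    (fun v _ ↦ Set.notMem_empty v)
    (fun c hc v hv _ hvT ↦ away_descent_of_splitBad_subset (W.baseChange K) p κ 𝔭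
      (↑(insert 𝔭 (nPlusPlaces_finite (W := W) (K := K) (p := p) hK).toFinset) :
        Set (HeightOneSpectrum (𝓞 K))) hK hκ
      (fun v' hpv hbad he' hf' ↦ Finset.mem_coe.mpr (Finset.mem_insert_of_mem
        (((nPlusPlaces_finite (W := W) (K := K) (p := p) hK).mem_toFinset).mpr
          (mem_nPlusPlaces_of v' hpv
            (primesEquiv_under_dvd_conductorNorm_of_not_hasGoodReductionAt K v' hbad) he' hf'))))
      c (selmerAc_empty_le hc) v hv (fun h ↦ hvT (Finset.mem_coe.mp h)))
    (fun v hv ↦ by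
      -- finiteness of the kernels on `T`
      rcases Finset.mem_insert.mp hv with rfl | hvS
      · exact hfin𝔭
      · exact (natCard_localKer_le_pow_padicValNat_localTamagawaNumber (W.baseChange K) κ
          (hSp v hvS)).1)
    ha' (b := b)
    (fun v hv ↦ by
      -- the bounds on `T`
      rcases Finset.mem_insert.mp hv with rfl | hvS
      · rw [hb𝔭, ← hmcard]; exact hle𝔭
      · rw [hbS v hvS]
        exact (natCard_localKer_le_pow_padicValNat_localTamagawaNumber (W.baseChange K) κ
          (hSp v hvS)).2)
  rw [hsum] at hle
  obtain ⟨n, hn, hnle⟩ := exists_hasCharValuationAt_le_of_natCard_invariants_le hfinγ hle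
  refine ⟨n, hn, ?_⟩
  rw [padicValNat_tamagawaProductSplit_eq_above_add_sum W p hK hsplit hpN]
  omega

end Control

end Summit.BirchSwinnertonDyer.BirchSwinnertonDyer.Theorems.BiquadraticEisensteinDescentControlCMInertBadAdmOtherAdditiveCount

end
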